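import Summits.AtomisticToContinuum.HydrodynamicLimit.Theorems.RelayRaceLocalityNearConstantShortTimeHLOrbitExpansion
import Summits.AtomisticToContinuum.HydrodynamicLimit.Theorems.RelayRaceLocalityNearConstantShortTimeHLOrbitIntegrabilityB
import Summits.AtomisticToContinuum.HydrodynamicLimit.Theorems.RelayRaceLocalityNearConstantShortTimeHLFluxIntegrability
import HarnessLib

/-!
# Crux `NearConstantShortTimeHL` (stmt-AtomisticToContinuum-12502), line `small-tilt-domination`:
# stub `weightedCell_bound` — part B: crude sizes of the cell integrand and the elementary assembly

Support file (lead c4) for the registered stub `weightedCell_bound` of the Grönwall assembly of the crux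
`…Theses.RelayRaceLocality.NearConstantShortTimeHL` (route: Yau's relative-entropy method for
deterministic hard spheres, Grönwall discretised on time cells; the stub itself is proved in
`…WeightedCell.lean`, which imports this file).  After the three balance rows with time-weighted tests
are summed, the cell quantity is `∫_s^{s+τ} (s+τ−r) R(r) dr` with
`R = ρ[∂ₜλ⁰] + Σₖ(m[∂ₖλ⁰])ₖ + Σⱼ(m[∂ₜλⱼ])ⱼ + ∫ₓ(momentum flux group) + e[∂ₜλ⁴] + ∫ₓ(energy flux group)`;
this file supplies the CRUDE sizes (no Dafermos expansion) and the real-variable assembly: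

* raw pairings: `xs_abs_density_le` (`|ρ_w[f]| ≤ Λ`), `xs_abs_mom_sum_le`
  (`|Σⱼ(m_w[gⱼ])ⱼ| ≤ 3Λ(1/2 + K)`, `wc_avg_speed_le`), `xs_abs_energy_le` (`|e_w[f]| ≤ ΛK`);
* flux groups on a ball, under a compressibility bound `Z` of the ball packing: `weightedCell_momFluxSize` (registered)
  (`≤ Λ(18 + 2Z)ẽ`: `|m̃ᵢm̃ⱼ/ρ̃| ≤ 2ẽ`, `|p̃| ≤ (2/3)Zẽ`), `xs_abs_enFlux_le` (`≤ Λ(3/2 + Z)c̃`: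
  `ẽ‖m̃‖ ≤ ρ̃c̃/2`), integrated in the centre by `xs_abs_integral_le` and `xs_integral_ballEnergy`
  (`∫ẽ = K`, unit mass of the kernel);
* assembly: `xs_combine` (the three rows into one window integral), `xs_final_bound`
  (`|∫ G| ≤ C₁τ(τ(1+K) + ∫cub)` from `|G| ≤ τC₁(1 + K + cub)` on `(s, s+τ]`), `xs_pointwise_algebra`,
  `xs_pointwise_bound`, `xs_constant_bookkeeping` (`Λ·4 + Λ(25+2Z)K + Λ(3/2+Z)c ≤ Λ(30+6Z)(1+K+c)`).

No definitions, no named facts.  References: H.-T. Yau, Lett. Math. Phys. 22 (1991) §2.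
-/

noncomputable section

namespace Summit.AtomisticToContinuum.HydrodynamicLimit.Theorems.NearConstantShortTimeHL

open scoped BigOperators ENNReal Topology
open MeasureTheory Set Filter
open Literature.MathematicalPhysics.KineticTheory Literature.Analysis.FluidPDE Literature.Analysis.FunctionSpaces

variable {n : ℕ}

/-! ### Crude sizes: the raw pairings and the two flux groups -/

/-- `|ρ_w[f]| ≤ Λ` if `|f| ≤ Λ` (an average of `n` numbers). [folklore] -/
theorem xs_abs_density_le (w : Config n (Fin 3) T3) {f : T3 → ℝ} {Λ : ℝ} (hΛ : 0 ≤ Λ)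
    (hf : ∀ x, |f x| ≤ Λ) : |empiricalDensityField w f| ≤ Λ := by
  have hn0 : 0 ≤ (n : ℝ)⁻¹ := inv_nonneg.2 (Nat.cast_nonneg n)
  rw [empiricalDensityField_eq_sum, abs_mul, abs_of_nonneg hn0]
  exact (mul_le_mul_of_nonneg_left (Finset.abs_sum_le_sum_abs _ _) hn0).trans
    (wg_avg_le (fun i => hf _) hΛ)

/-- `|e_w[f]| ≤ Λ K(w)` if `|f| ≤ Λ`, `K = n⁻¹Σ‖vᵢ‖²/2`. [folklore] -/
theorem xs_abs_energy_le (w : Config n (Fin 3) T3) {f : T3 → ℝ} {Λ : ℝ}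
    (hf : ∀ x, |f x| ≤ Λ) : |empiricalEnergyField w f| ≤ Λ * kineticPP w := by
  have hn0 : 0 ≤ (n : ℝ)⁻¹ := inv_nonneg.2 (Nat.cast_nonneg n)
  rw [empiricalEnergyField_eq_sum, abs_mul, abs_of_nonneg hn0]
  calc (n : ℝ)⁻¹ * |∑ i, f (w i).1 * (‖(w i).2‖ ^ 2 / 2)|
      ≤ (n : ℝ)⁻¹ * ∑ i, Λ * (‖(w i).2‖ ^ 2 / 2) := by
        refine mul_le_mul_of_nonneg_left ((Finset.abs_sum_le_sum_abs _ _).trans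
          (Finset.sum_le_sum fun i _ => ?_)) hn0
        rw [abs_mul, abs_of_nonneg (by positivity : (0 : ℝ) ≤ ‖(w i).2‖ ^ 2 / 2)]
        exact mul_le_mul_of_nonneg_right (hf _) (by positivity)
    _ = Λ * kineticPP w := by
        unfold kineticPP
        rw [← Finset.mul_sum]
        ring

/-- `|Σⱼ (m_w[gⱼ])ⱼ| ≤ 3Λ (1/2 + K(w))` if `|gⱼ| ≤ Λ` (`|vⱼ| ≤ ‖v‖ ≤ 1/2 + ‖v‖²/2`, `wc_avg_speed_le`),
`n ≥ 1`. [folklore] -/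
theorem xs_abs_mom_sum_le (hn : n ≠ 0) (w : Config n (Fin 3) T3) {g : Fin 3 → T3 → ℝ} {Λ : ℝ}
    (hΛ : 0 ≤ Λ) (hg : ∀ j x, |g j x| ≤ Λ) :
    |∑ j, (empiricalMomentumField w (g j)) j| ≤ 3 * Λ * (1 / 2 + kineticPP w) := by
  have hn0 : 0 ≤ (n : ℝ)⁻¹ := inv_nonneg.2 (Nat.cast_nonneg n)
  have hA := wc_avg_speed_le hn w
  have hvj : ∀ (v : V3) (j : Fin 3), |v j| ≤ ‖v‖ := fun v j => by
    have h := PiLp.norm_apply_le v j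
    rwa [Real.norm_eq_abs] at h
  have h1 : ∀ j, |(empiricalMomentumField w (g j)) j| ≤ Λ * ((n : ℝ)⁻¹ * ∑ i, ‖(w i).2‖) :=
    fun j => by
    rw [empiricalMomentumField_apply_eq_sum, abs_mul, abs_of_nonneg hn0]
    calc (n : ℝ)⁻¹ * |∑ i, g j (w i).1 * (w i).2 j| ≤ (n : ℝ)⁻¹ * ∑ i, Λ * ‖(w i).2‖ :=
          mul_le_mul_of_nonneg_left ((Finset.abs_sum_le_sum_abs _ _).trans
            (Finset.sum_le_sum fun i _ => by
              rw [abs_mul]; exact mul_le_mul (hg j _) (hvj _ j) (abs_nonneg _) hΛ)) hn0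
      _ = Λ * ((n : ℝ)⁻¹ * ∑ i, ‖(w i).2‖) := by rw [← Finset.mul_sum]; ring
  have hΛA : Λ * ((n : ℝ)⁻¹ * ∑ i, ‖(w i).2‖) ≤ Λ * (1 / 2 + kineticPP w) :=
    mul_le_mul_of_nonneg_left hA hΛ
  calc |∑ j, (empiricalMomentumField w (g j)) j| ≤ ∑ j, |(empiricalMomentumField w (g j)) j| :=
        Finset.abs_sum_le_sum_abs _ _
    _ ≤ ∑ _j : Fin 3, Λ * ((n : ℝ)⁻¹ * ∑ i, ‖(w i).2‖) := Finset.sum_le_sum fun j _ => h1 j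
    _ = 3 * (Λ * ((n : ℝ)⁻¹ * ∑ i, ‖(w i).2‖)) := by
        simp only [Finset.sum_const, Finset.card_univ, Fintype.card_fin, nsmul_eq_mul, Nat.cast_ofNat]
    _ ≤ 3 * (Λ * (1 / 2 + kineticPP w)) := by linarith
    _ = 3 * Λ * (1 / 2 + kineticPP w) := by ring

/-- **Registered intermediate `weightedCell_momFluxSize`: crude size of the momentum flux group on a ball.** With `|cᵢⱼ| ≤ Λ`, `|d| ≤ 3Λ` and the
compressibility of the ball packing bounded by `Z`:
`|Σᵢⱼ cᵢⱼ m̃ᵢm̃ⱼ/ρ̃ + p̃ d| ≤ Λ (18 + 2Z) ẽ` (`|m̃ᵢm̃ⱼ/ρ̃| ≤ 2ẽ`, `|p̃| ≤ (2/3) Z ẽ`). [cite: Yau1991, §2] -/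
theorem weightedCell_momFluxSize : ∀ {n : ℕ} {σ Λ Z : ℝ} (ℓ : ℝ) (x : T3) (w : Config n (Fin 3) T3) {c : Fin 3 → Fin 3 → ℝ} {d : ℝ}, (∀ i j, |c i j| ≤ Λ) → |d| ≤ 3 * Λ → 0 ≤ Z → |hsCompressibility (empiricalDensityField w (ballKernel ℓ x) * σ ^ 3)| ≤ Z → |(∑ i, ∑ j, c i j * (empiricalMomentumField w (ballKernel ℓ x) i * empiricalMomentumField w (ballKernel ℓ x) j / empiricalDensityField w (ballKernel ℓ x))) + hsPressure σ (empiricalDensityField w (ballKernel ℓ x)) (2 / 3 * (empiricalEnergyField w (ballKernel ℓ x) / empiricalDensityField w (ballKernel ℓ x) - ‖empiricalMomentumField w (ballKernel ℓ x)‖ ^ 2 / (2 * empiricalDensityField w (ballKernel ℓ x) ^ 2))) * d| ≤ Λ * (18 + 2 * Z) * empiricalEnergyField w (ballKernel ℓ x) := by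
  intro n σ Λ Z ℓ x w c d hc hd hZ0 hZ
  have hE := ballEnergy_nonneg ℓ x w
  have hΛ : 0 ≤ Λ := (abs_nonneg _).trans (hc 0 0)
  have h1 : |∑ i, ∑ j, c i j * (empiricalMomentumField w (ballKernel ℓ x) i *
      empiricalMomentumField w (ballKernel ℓ x) j / empiricalDensityField w (ballKernel ℓ x))| ≤
      18 * Λ * empiricalEnergyField w (ballKernel ℓ x) := by
    refine (Finset.abs_sum_le_sum_abs _ _).trans ?_
    refine (Finset.sum_le_sum fun i _ => Finset.abs_sum_le_sum_abs _ _).trans ?_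
    calc ∑ i, ∑ j, |c i j * (empiricalMomentumField w (ballKernel ℓ x) i *
          empiricalMomentumField w (ballKernel ℓ x) j / empiricalDensityField w (ballKernel ℓ x))|
        ≤ ∑ _i : Fin 3, ∑ _j : Fin 3, Λ * (2 * empiricalEnergyField w (ballKernel ℓ x)) :=
          Finset.sum_le_sum fun i _ => Finset.sum_le_sum fun j _ => by
            rw [abs_mul]
            exact mul_le_mul (hc i j) (wg_abs_momProd_div_le ℓ x w i j) (abs_nonneg _) hΛ
      _ = 18 * Λ * empiricalEnergyField w (ballKernel ℓ x) := by
          simp only [Finset.sum_const, Finset.card_univ, Fintype.card_fin, nsmul_eq_mul, Nat.cast_ofNat]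
          ring
  have hp : |hsPressure σ (empiricalDensityField w (ballKernel ℓ x))
      (2 / 3 * (empiricalEnergyField w (ballKernel ℓ x) / empiricalDensityField w (ballKernel ℓ x) -
        ‖empiricalMomentumField w (ballKernel ℓ x)‖ ^ 2 /
          (2 * empiricalDensityField w (ballKernel ℓ x) ^ 2)))| ≤
      2 / 3 * Z * empiricalEnergyField w (ballKernel ℓ x) := by
    have h := wf_abs_pressure_le (ballDensity_nonneg ℓ x w) hE (norm_ballMomentum_sq_le ℓ x w) hZ
    unfold stateTemp at h
    exact h
  have h2 : |hsPressure σ (empiricalDensityField w (ballKernel ℓ x))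
      (2 / 3 * (empiricalEnergyField w (ballKernel ℓ x) / empiricalDensityField w (ballKernel ℓ x) -
        ‖empiricalMomentumField w (ballKernel ℓ x)‖ ^ 2 /
          (2 * empiricalDensityField w (ballKernel ℓ x) ^ 2))) * d| ≤
      2 / 3 * Z * empiricalEnergyField w (ballKernel ℓ x) * (3 * Λ) := by
    rw [abs_mul]
    exact mul_le_mul hp hd (abs_nonneg _) (by positivity)
  refine (abs_add_le _ _).trans ((add_le_add h1 h2).trans (le_of_eq ?_))
  ring

/-- **Crude size of the energy flux group on a ball.** With `|eᵢ| ≤ Λ` and the compressibility of the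
ball packing bounded by `Z`: `|(ẽ + p̃) Σᵢ (m̃ᵢ/ρ̃) eᵢ| ≤ Λ (3/2 + Z) c̃`, `c̃ = n⁻¹Σᵢ kᵢ‖vᵢ‖³`
(`|p̃| ≤ (2/3)Zẽ`, `ẽ‖m̃‖ ≤ ρ̃c̃/2`; divisions by `ρ̃ = 0` vanish). [cite: Yau1991, §2] -/
theorem xs_abs_enFlux_le {σ Λ Z : ℝ} (ℓ : ℝ) (x : T3) (w : Config n (Fin 3) T3) {e : Fin 3 → ℝ}
    (he : ∀ i, |e i| ≤ Λ) (hZ0 : 0 ≤ Z)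
    (hZ : |hsCompressibility (empiricalDensityField w (ballKernel ℓ x) * σ ^ 3)| ≤ Z) :
    |(empiricalEnergyField w (ballKernel ℓ x) + hsPressure σ (empiricalDensityField w (ballKernel ℓ x))
        (2 / 3 * (empiricalEnergyField w (ballKernel ℓ x) / empiricalDensityField w (ballKernel ℓ x) -
          ‖empiricalMomentumField w (ballKernel ℓ x)‖ ^ 2 /
            (2 * empiricalDensityField w (ballKernel ℓ x) ^ 2)))) *
      (∑ i, (empiricalMomentumField w (ballKernel ℓ x) i / empiricalDensityField w (ballKernel ℓ x)) *
        e i)| ≤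
      Λ * (3 / 2 + Z) * ((n : ℝ)⁻¹ * ∑ i, ballKernel ℓ x (w i).1 * ‖(w i).2‖ ^ 3) := by
  set ρ' := empiricalDensityField w (ballKernel ℓ x) with hρ'def
  set E' := empiricalEnergyField w (ballKernel ℓ x) with hE'def
  set m' := empiricalMomentumField w (ballKernel ℓ x) with hm'def
  set cc := (n : ℝ)⁻¹ * ∑ i, ballKernel ℓ x (w i).1 * ‖(w i).2‖ ^ 3 with hccdef
  set P := hsPressure σ ρ' (2 / 3 * (E' / ρ' - ‖m'‖ ^ 2 / (2 * ρ' ^ 2))) with hPdef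
  have hρ' : 0 ≤ ρ' := ballDensity_nonneg ℓ x w
  have hE' : 0 ≤ E' := ballEnergy_nonneg ℓ x w
  have hcc : 0 ≤ cc := mul_nonneg (inv_nonneg.2 (Nat.cast_nonneg _))
    (Finset.sum_nonneg fun i _ => mul_nonneg (ballKernel_nonneg _ _ _) (by positivity))
  have hΛ : 0 ≤ Λ := (abs_nonneg _).trans (he 0)
  have hEm : E' * ‖m'‖ ≤ ρ' / 2 * cc := ballEnergy_mul_norm_ballMomentum_le ℓ x w
  have hp : |P| ≤ 2 / 3 * Z * E' := by
    have h := wf_abs_pressure_le (ballDensity_nonneg ℓ x w) (ballEnergy_nonneg ℓ x w)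
      (norm_ballMomentum_sq_le ℓ x w) hZ
    unfold stateTemp at h
    exact h
  have hmj : ∀ j, |m' j| ≤ ‖m'‖ := fun j => by
    have h := PiLp.norm_apply_le m' j
    rwa [Real.norm_eq_abs] at h
  have hflux : ∀ k, |(E' + P) * m' k / ρ'| ≤ (1 + 2 / 3 * Z) * (cc / 2) := fun k => by
    rcases hρ'.eq_or_lt with h0 | hpos
    · rw [← h0, div_zero, abs_zero]; positivity
    · rw [abs_div, abs_mul, abs_of_pos hpos, div_le_iff₀ hpos]
      have h1 : |E' + P| ≤ (1 + 2 / 3 * Z) * E' := by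
        calc |E' + P| ≤ |E'| + |P| := abs_add_le _ _
          _ ≤ E' + 2 / 3 * Z * E' := by rw [abs_of_nonneg hE']; linarith
          _ = (1 + 2 / 3 * Z) * E' := by ring
      calc |E' + P| * |m' k| ≤ (1 + 2 / 3 * Z) * E' * ‖m'‖ :=
            mul_le_mul h1 (hmj k) (abs_nonneg _) (by positivity)
        _ = (1 + 2 / 3 * Z) * (E' * ‖m'‖) := by ring
        _ ≤ (1 + 2 / 3 * Z) * (ρ' / 2 * cc) := mul_le_mul_of_nonneg_left hEm (by positivity)
        _ = (1 + 2 / 3 * Z) * (cc / 2) * ρ' := by ring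
  have hre : (E' + P) * ∑ i, (m' i / ρ') * e i = ∑ i, e i * ((E' + P) * m' i / ρ') := by
    rw [Finset.mul_sum]
    exact Finset.sum_congr rfl fun i _ => by ring
  rw [hre]
  refine (Finset.abs_sum_le_sum_abs _ _).trans ?_
  calc ∑ i, |e i * ((E' + P) * m' i / ρ')| ≤ ∑ _i : Fin 3, Λ * ((1 + 2 / 3 * Z) * (cc / 2)) :=
        Finset.sum_le_sum fun i _ => by
          rw [abs_mul]; exact mul_le_mul (he i) (hflux i) (abs_nonneg _) hΛ
    _ = Λ * (3 / 2 + Z) * cc := by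
        simp only [Finset.sum_const, Finset.card_univ, Fintype.card_fin, nsmul_eq_mul, Nat.cast_ofNat]
        ring

/-- Integrating a pointwise bound `|F| ≤ c g` over the torus: `|∫ F| ≤ c ∫ g` (`g` integrable). [folklore] -/
theorem xs_abs_integral_le {F g : T3 → ℝ} {c : ℝ} (hg : Integrable g) (h : ∀ x, |F x| ≤ c * g x) :
    |∫ x, F x| ≤ c * ∫ x, g x := by
  rw [← integral_const_mul, ← Real.norm_eq_abs]
  exact norm_integral_le_of_norm_le (hg.const_mul c) (ae_of_all _ fun x => by
    rw [Real.norm_eq_abs]; exact h x)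

/-- The ball-averaged energy integrates to the kinetic energy per particle: `∫ ẽ_w dx = K(w)`
(`0 < ℓ < 1/2`, unit mass of the kernel). [folklore] -/
theorem xs_integral_ballEnergy {ℓ : ℝ} (hℓ0 : 0 < ℓ) (hℓ : ℓ < 1 / 2) (w : Config n (Fin 3) T3) :
    ∫ x, empiricalEnergyField w (ballKernel ℓ x) = kineticPP w := by
  simp_rw [empiricalEnergyField_eq_sum]
  exact integral_ballAverage_eq hℓ0 hℓ (fun v => ‖v‖ ^ 2 / 2) w

/-! ### Elementary assembly -/

/-- **Combining the three rows.** With `−τ P_s = ∫ D'` (mass row) and interval integrable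
`X, D', M', N'`: `∫X − τ(P_s + A_s + E_s) − (−τA_s − ∫M') − (−τE_s − ∫N') = ∫ (X + D' + M' + N')`.
[folklore] -/
theorem xs_combine {s τ Ps As Es : ℝ} {X D' M' N' : ℝ → ℝ}
    (hX : IntervalIntegrable X volume s (s + τ)) (hD' : IntervalIntegrable D' volume s (s + τ))
    (hM' : IntervalIntegrable M' volume s (s + τ)) (hN' : IntervalIntegrable N' volume s (s + τ))
    (hmass : 0 - τ * Ps = ∫ r in s..(s + τ), D' r) :
    (∫ r in s..(s + τ), X r) - τ * (Ps + As + Es) - (-(τ * As) - ∫ r in s..(s + τ), M' r) -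
        (-(τ * Es) - ∫ r in s..(s + τ), N' r) =
      ∫ r in s..(s + τ), (X r + D' r + M' r + N' r) := by
  rw [intervalIntegral.integral_add ((hX.add hD').add hM') hN',
    intervalIntegral.integral_add (hX.add hD') hM', intervalIntegral.integral_add hX hD']
  linarith

/-- **The window integration.** If `|G| ≤ τ C₁ (1 + K + cub)` on `(s, s+τ]` with `cub` interval
integrable, then `|∫_s^{s+τ} G| ≤ C₁ τ (τ(1 + K) + ∫ cub)`. [folklore] -/
theorem xs_final_bound {s τ C₁ K : ℝ} (hτ : 0 < τ) {G cub : ℝ → ℝ}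
    (hcub : IntervalIntegrable cub volume s (s + τ))
    (hpt : ∀ r ∈ Set.Ioc s (s + τ), |G r| ≤ τ * (C₁ * (1 + K + cub r))) :
    |∫ r in s..(s + τ), G r| ≤ C₁ * τ * (τ * (1 + K) + ∫ r in s..(s + τ), cub r) := by
  have hsτ : s ≤ s + τ := by linarith
  have hb : IntervalIntegrable (fun r => τ * (C₁ * (1 + K + cub r))) volume s (s + τ) :=
    ((intervalIntegrable_const.add hcub).const_mul C₁).const_mul τ
  have h := intervalIntegral.norm_integral_le_of_norm_le hsτ
    (ae_of_all _ fun r hr => by rw [Real.norm_eq_abs]; exact hpt r hr) hb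
  rw [Real.norm_eq_abs] at h
  refine h.trans (le_of_eq ?_)
  rw [intervalIntegral.integral_const_mul, intervalIntegral.integral_const_mul,
    intervalIntegral.integral_add intervalIntegrable_const hcub, intervalIntegral.integral_const,
    smul_eq_mul, add_sub_cancel_left]
  ring

/-- Bookkeeping of the crude constant: `Λ·4 + Λ(25 + 2Z)K + Λ(3/2 + Z)c ≤ Λ(30 + 6Z)(1 + K + c)` for
`Λ, Z, K, c ≥ 0`. [folklore] -/
theorem xs_constant_bookkeeping {Λ Z K c : ℝ} (hΛ : 0 ≤ Λ) (hZ : 0 ≤ Z) (hK : 0 ≤ K) (hc : 0 ≤ c) :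
    Λ * 4 + Λ * (25 + 2 * Z) * K + Λ * (3 / 2 + Z) * c ≤ Λ * (30 + 6 * Z) * (1 + K + c) := by
  have h1 : Λ * 4 ≤ Λ * (30 + 6 * Z) := mul_le_mul_of_nonneg_left (by linarith) hΛ
  have h2 : Λ * (25 + 2 * Z) * K ≤ Λ * (30 + 6 * Z) * K :=
    mul_le_mul_of_nonneg_right (mul_le_mul_of_nonneg_left (by linarith) hΛ) hK
  have h3 : Λ * (3 / 2 + Z) * c ≤ Λ * (30 + 6 * Z) * c :=
    mul_le_mul_of_nonneg_right (mul_le_mul_of_nonneg_left (by linarith) hΛ) hc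
  nlinarith [h1, h2, h3]

/-- Pointwise algebra of the cell integrand: `P + A + E + (−P + wD) + (−A + wM) + (−E + wN) = w(D + M + N)`,
so a bound `|D + M + N| ≤ B` gives `≤ wB` for `w ≥ 0`. [folklore] -/
theorem xs_pointwise_algebra {w P A E D M N B : ℝ} (hw0 : 0 ≤ w) (h : |D + M + N| ≤ B) :
    |P + A + E + (-P + w * D) + (-A + w * M) + (-E + w * N)| ≤ w * B := by
  have e : P + A + E + (-P + w * D) + (-A + w * M) + (-E + w * N) = w * (D + M + N) := by ring
  rw [e, abs_mul, abs_of_nonneg hw0]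
  exact mul_le_mul_of_nonneg_left h hw0

/-- Pointwise size of the cell integrand from the six crude sizes (raw linear terms and the two flux
groups): total `≤ Λ(30 + 6Z)(1 + K + c)`. [folklore] -/
theorem xs_pointwise_bound {D1 D2 M1 M2 N1 N2 Λ Z K c : ℝ} (hΛ : 0 ≤ Λ) (hZ : 0 ≤ Z) (hK : 0 ≤ K)
    (hc : 0 ≤ c) (b1 : |D1| ≤ Λ) (b2 : |D2| ≤ 3 * Λ * (1 / 2 + K)) (b3 : |M1| ≤ 3 * Λ * (1 / 2 + K))
    (b5 : |M2| ≤ Λ * (18 + 2 * Z) * K) (b4 : |N1| ≤ Λ * K) (b6 : |N2| ≤ Λ * (3 / 2 + Z) * c) :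
    |D1 + D2 + (M1 + M2) + (N1 + N2)| ≤ Λ * (30 + 6 * Z) * (1 + K + c) := by
  obtain ⟨l1, u1⟩ := abs_le.1 b1
  obtain ⟨l2, u2⟩ := abs_le.1 b2
  obtain ⟨l3, u3⟩ := abs_le.1 b3
  obtain ⟨l4, u4⟩ := abs_le.1 b4
  obtain ⟨l5, u5⟩ := abs_le.1 b5
  obtain ⟨l6, u6⟩ := abs_le.1 b6
  have hb := xs_constant_bookkeeping hΛ hZ hK hc
  rw [abs_le]
  constructor <;> linarith

end Summit.AtomisticToContinuum.HydrodynamicLimit.Theorems.NearConstantShortTimeHL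

end
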